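import Mathlib
import HarnessLib
import Summits.ResolutionOfSingularities.ResolutionOfSingularities.Theorems.WildQuotientsWildQuotientResolutionConductorOneChartSigma
import Summits.ResolutionOfSingularities.ResolutionOfSingularities.Theorems.WildQuotientsWildQuotientResolutionConductorOneSliceLemmas

/-!
# S2 F5b (part 2c): σ-fixed elements of the straightened chart ring lie in the span of the cone monomials
(crux stmt-ResolutionOfSingularities-15640 `WildQuotients.WildQuotientResolution`, line `Sketch`;
chain w45c post-V5 programme S2, design `L/res-L1-w45c-lead-1/S2-DESIGN.md` v1.1 §7 (7.2)/(7.7),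
res-L1-w45c-plan-1 RULING 2026-08-27T17:07:17Z (R4) «normality-free graded one-variable route».
[OURS · L1 W4.5c] — NOT a statement of the manuscript. Lead prover res-L1-w45c-lead-1.)

**`ConductorOne.mem_span_chartMono_of_fixed`** — the heart of CLAIM P: for the straightened chart
ring `M = ChartRing k p n i I` (`i ∈ I`) and a `k`-algebra endomorphism `σ` with the diagonal-Möbius
laws, every `σ`-fixed `x ∈ M` satisfies `x · N'^r ∈ span_k {x^m · u^{−d(m)} : weight(m) = 0}` for
some `r` (`N'` the invariant norm unit `ConductorOne.chartNu`). Proof (design (7.7)): write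
`x · N'^r = b(x)·v^t` (`exists_mul_chartNu_pow_eq`), decompose `b = ∑_{m̄} x^{m̄} P_{m̄}(xᵢ)` into
`k[xᵢ]`-slices (`eq_sum_slices`), turn `σ y = y` into ONE identity in `k[x]` (injectivity of
`k[x] → M`), read it slice by slice (`sliced_eq_zero`) as `Φ_L(P_{m̄}) = (1+X)^N P_{m̄}`, and apply the
one-variable normal form `exists_normalForm_of_twistSubst_eq_level`: each slice is a `k`-combination
of `s^{a} u^{d'}` with `x^{m̄} s^a u^{d'} v^t` a cone monomial image `chartMono`.
-/

-- single-problem summit: the doubled namespace component `ResolutionOfSingularities` is forced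
set_option linter.dupNamespace false

noncomputable section

open MvPolynomial

namespace Summit.ResolutionOfSingularities.ResolutionOfSingularities.Theorems.WildQuotientResolution.ConductorOne

section FixedSpan

variable (k : Type) [Field k] (p n : ℕ) (i : Fin n) (I : Finset (Fin n))

/-- `twistDeg m = A(m) − B(m)`. [OURS · L1 W4.5c] -/
theorem twistDeg_eq_degA_sub_degB (m : Fin n →₀ ℕ) :
    twistDeg n I m = (degA n I m : ℤ) - (degB n I m : ℤ) := by
  rw [twistDeg, degA, degB]
  push_cast
  rfl

/-- `twistDeg (a·eᵢ) = a` for `i ∈ I`. [OURS · L1 W4.5c] -/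
theorem twistDeg_single_self (hi : i ∈ I) (a : ℕ) : twistDeg n I (Finsupp.single i a) = a := by
  classical
  rw [twistDeg]
  rw [Finset.sum_eq_single i (fun l _ hl => by rw [Finsupp.single_apply, if_neg (Ne.symm hl)]; simp)
    (fun h => absurd hi h), Finsupp.single_eq_same]
  rw [Finset.sum_eq_zero (fun l hl => by
    have hl' : l ≠ i := fun h => (Finset.mem_sdiff.mp hl).2 (h ▸ hi)
    rw [Finsupp.single_apply, if_neg (Ne.symm hl')]; simp)]
  simp

/-- `A(m̄ + a·eᵢ) = A(m̄) + a` (`i ∈ I`). [OURS · L1 W4.5c] -/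
theorem degA_add_single (hi : i ∈ I) (mb : Fin n →₀ ℕ) (a : ℕ) :
    degA n I (mb + Finsupp.single i a) = degA n I mb + a := by
  classical
  rw [degA, degA]
  simp only [Finsupp.add_apply, Finset.sum_add_distrib]
  congr 1
  rw [Finset.sum_eq_single_of_mem i hi (fun l _ hl => by
    rw [Finsupp.single_apply, if_neg (Ne.symm hl)])]
  exact Finsupp.single_eq_same

/-- `B` ignores the `i`-coordinate (`i ∈ I`). [OURS · L1 W4.5c] -/
theorem degB_add_single (hi : i ∈ I) (mb : Fin n →₀ ℕ) (a : ℕ) :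
    degB n I (mb + Finsupp.single i a) = degB n I mb := by
  classical
  rw [degB, degB]
  refine Finset.sum_congr rfl fun l hl => ?_
  have hl' : l ≠ i := fun h => (Finset.mem_sdiff.mp hl).2 (h ▸ hi)
  rw [Finsupp.add_apply, Finsupp.single_apply, if_neg (Ne.symm hl'), add_zero]

/-- Evaluation of a normal-form term: `aeval s (c · X^a · (1 − X^{p−1})^d) = c · s^a · u^d`.
[OURS · L1 W4.5c] -/
theorem aeval_normalForm_term (c : k) (a d : ℕ) :
    Polynomial.aeval (chartX k p n i I i)
        (Polynomial.C c * Polynomial.X ^ a * (1 - Polynomial.X ^ (p - 1)) ^ d) =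
      algebraMap k (ChartRing k p n i I) c * chartX k p n i I i ^ a *
        (1 - chartX k p n i I i ^ (p - 1)) ^ d := by
  rw [map_mul, map_mul, map_pow, map_pow, map_sub, map_one, map_pow, Polynomial.aeval_C,
    Polynomial.aeval_X]

/-- `ι (x^{m̄} ) · s^a = ι (x^{m̄ + a eᵢ})`. [OURS · L1 W4.5c] -/
theorem algebraMap_monomial_mul_pow (mb : Fin n →₀ ℕ) (a : ℕ) :
    algebraMap (MvPolynomial (Fin n) k) (ChartRing k p n i I) (monomial mb 1) * chartX k p n i I i ^ a =
      algebraMap (MvPolynomial (Fin n) k) (ChartRing k p n i I) (monomial (mb + Finsupp.single i a) 1) := by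
  rw [chartX, ← map_pow, ← map_mul, X_pow_eq_monomial, monomial_mul, one_mul]

/-- The unit bookkeeping `U^{−(t−d)} = u^d · v^t`. [OURS · L1 W4.5c] -/
theorem val_chartUUnit_zpow (d t : ℕ) :
    ((chartUUnit k p n i I ^ (-((t : ℤ) - d)) : (ChartRing k p n i I)ˣ) : ChartRing k p n i I) =
      (1 - chartX k p n i I i ^ (p - 1)) ^ d * chartV k p n i I ^ t := by
  rw [neg_sub, zpow_sub, zpow_natCast, zpow_natCast, ← inv_pow, Units.val_mul,
    Units.val_pow_eq_pow_val, Units.val_pow_eq_pow_val, val_chartUUnit, val_chartUUnit_inv]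

/-- `ι (aeval (X i) Q) = aeval s Q`. [OURS · L1 W4.5c] -/
theorem algebraMap_aeval_X (Q : Polynomial k) :
    algebraMap (MvPolynomial (Fin n) k) (ChartRing k p n i I) (Polynomial.aeval (X i) Q) =
      Polynomial.aeval (chartX k p n i I i) Q := by
  have h := Polynomial.aeval_algHom_apply
    (IsScalarTower.toAlgHom k (MvPolynomial (Fin n) k) (ChartRing k p n i I)) (X i) Q
  rw [IsScalarTower.toAlgHom_apply] at h
  exact h.symm

variable [Fact p.Prime] [CharP k p]
variable (σ : ChartRing k p n i I →ₐ[k] ChartRing k p n i I)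
  (hσ : IsChartAction k p n i I (σ : ChartRing k p n i I →+* ChartRing k p n i I))

include hσ in
/-- `(1+s)^D · σ (Q(s)) = (Φ_D Q)(s)` for `natDegree Q ≤ D` (`i ∈ I`). [OURS · L1 W4.5c] -/
theorem sigma_aeval_mul_pow (hi : i ∈ I) (Q : Polynomial k) (D : ℕ) (hQ : Q.natDegree ≤ D) :
    (1 + chartX k p n i I i) ^ D * σ (Polynomial.aeval (chartX k p n i I i) Q) =
      Polynomial.aeval (chartX k p n i I i) (twistSubst D Q) := by
  rw [← Polynomial.aeval_algHom_apply, sigma_chartX k p n i I σ hσ i]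
  unfold chartTheta
  rw [if_pos hi]
  exact twist_aeval (chartX k p n i I i) (chartW k p n i I) (one_add_chartS_mul_chartW k p n i I) Q D hQ

include hσ in
/-- **The slice computation, `σ`-side**: for `A(m̄) ≤ Amax` and `natDegree P ≤ D₀`,
`σ(x^{m̄} · P(s) · v^t) · (u^t (1+s)^{Amax+D₀}) = x^{m̄} · (Φ_{D₀+e} P)(s)`,
`e = Amax − A(m̄) + B(m̄) + p t`. [OURS · L1 W4.5c] -/
theorem sigma_slice_mul (hi : i ∈ I) (mb : Fin n →₀ ℕ) (P : Polynomial k) (D₀ Amax t : ℕ)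
    (hA : degA n I mb ≤ Amax) (hP : P.natDegree ≤ D₀) :
    σ (algebraMap (MvPolynomial (Fin n) k) (ChartRing k p n i I) (monomial mb 1) *
        Polynomial.aeval (chartX k p n i I i) P * chartV k p n i I ^ t) *
      ((1 - chartX k p n i I i ^ (p - 1)) ^ t * (1 + chartX k p n i I i) ^ (Amax + D₀)) =
    algebraMap (MvPolynomial (Fin n) k) (ChartRing k p n i I) (monomial mb 1) *
      Polynomial.aeval (chartX k p n i I i)
        (twistSubst (D₀ + (Amax - degA n I mb + degB n I mb + p * t)) P) := by
  have hR : Polynomial.aeval (chartX k p n i I i)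
      ((1 + Polynomial.X) ^ (Amax - degA n I mb + degB n I mb + p * t) * twistSubst D₀ P) =
      (1 + chartX k p n i I i) ^ (Amax - degA n I mb + degB n I mb + p * t) *
        ((1 + chartX k p n i I i) ^ D₀ * σ (Polynomial.aeval (chartX k p n i I i) P)) := by
    rw [map_mul, map_pow, map_add, map_one, Polynomial.aeval_X,
      sigma_aeval_mul_pow k p n i I σ hσ hi P D₀ hP]
  have hL : σ (algebraMap (MvPolynomial (Fin n) k) (ChartRing k p n i I) (monomial mb 1) *
        Polynomial.aeval (chartX k p n i I i) P * chartV k p n i I ^ t) =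
      algebraMap (MvPolynomial (Fin n) k) (ChartRing k p n i I) (monomial mb 1) *
        chartW k p n i I ^ degA n I mb * (1 + chartX k p n i I i) ^ degB n I mb *
        σ (Polynomial.aeval (chartX k p n i I i) P) * (chartV k p n i I * (1 + chartX k p n i I i) ^ p) ^ t := by
    rw [map_mul, map_mul, map_pow, sigma_algebraMap_monomial k p n i I σ hσ mb 1,
      sigma_chartV k p n i I σ hσ]
  rw [twistSubst_add_level P D₀ _ hP, hR, hL]
  -- pure commutative algebra with the two unit relations
  have hws : (1 + chartX k p n i I i) * chartW k p n i I = 1 := one_add_chartS_mul_chartW k p n i I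
  have huv : (1 - chartX k p n i I i ^ (p - 1)) * chartV k p n i I = 1 := chartU_mul_chartV k p n i I
  have hsplit : Amax = (Amax - degA n I mb) + degA n I mb := (Nat.sub_add_cancel hA).symm
  -- `(1+s)^{A} w^{A} = 1`, `(v (1+s)^p)^t u^t = (1+s)^{pt}`
  have h1 : (1 + chartX k p n i I i) ^ degA n I mb * chartW k p n i I ^ degA n I mb = 1 := by
    rw [← mul_pow, hws, one_pow]
  have h2 : (chartV k p n i I * (1 + chartX k p n i I i) ^ p) ^ t *
      (1 - chartX k p n i I i ^ (p - 1)) ^ t = (1 + chartX k p n i I i) ^ (p * t) := by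
    rw [mul_pow, ← pow_mul, mul_comm (chartV k p n i I ^ t), mul_assoc, mul_comm (chartV k p n i I ^ t),
      ← mul_pow, huv, one_pow, mul_one]
  set Mo := algebraMap (MvPolynomial (Fin n) k) (ChartRing k p n i I) (monomial mb 1)
  set S := chartX k p n i I i
  set W := chartW k p n i I
  set V := chartV k p n i I
  set G := σ (Polynomial.aeval S P)
  calc Mo * W ^ degA n I mb * (1 + S) ^ degB n I mb * G * (V * (1 + S) ^ p) ^ t *
        ((1 - S ^ (p - 1)) ^ t * (1 + S) ^ (Amax + D₀))
      = Mo * ((1 + S) ^ Amax * W ^ degA n I mb) * (1 + S) ^ degB n I mb *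
          ((V * (1 + S) ^ p) ^ t * (1 - S ^ (p - 1)) ^ t) * ((1 + S) ^ D₀ * G) := by ring
    _ = Mo * (1 + S) ^ (Amax - degA n I mb) * (1 + S) ^ degB n I mb * (1 + S) ^ (p * t) *
          ((1 + S) ^ D₀ * G) := by
        rw [h2, hsplit, pow_add, mul_assoc ((1 + S) ^ (Amax - degA n I mb)), h1, mul_one,
          Nat.add_sub_cancel]
    _ = Mo * ((1 + S) ^ (Amax - degA n I mb + degB n I mb + p * t) * ((1 + S) ^ D₀ * G)) := by
        rw [pow_add, pow_add]; ring

omit [Fact p.Prime] [CharP k p] in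
/-- **The slice computation, plain side**: `(x^{m̄} · P(s) · v^t) · (u^t (1+s)^{N}) = x^{m̄} · ((1+X)^N P)(s)`.
[OURS · L1 W4.5c] -/
theorem slice_mul (mb : Fin n →₀ ℕ) (P : Polynomial k) (N t : ℕ) :
    algebraMap (MvPolynomial (Fin n) k) (ChartRing k p n i I) (monomial mb 1) *
        Polynomial.aeval (chartX k p n i I i) P * chartV k p n i I ^ t *
      ((1 - chartX k p n i I i ^ (p - 1)) ^ t * (1 + chartX k p n i I i) ^ N) =
    algebraMap (MvPolynomial (Fin n) k) (ChartRing k p n i I) (monomial mb 1) *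
      Polynomial.aeval (chartX k p n i I i) ((1 + Polynomial.X) ^ N * P) := by
  have huv : (1 - chartX k p n i I i ^ (p - 1)) * chartV k p n i I = 1 := chartU_mul_chartV k p n i I
  have h2 : chartV k p n i I ^ t * (1 - chartX k p n i I i ^ (p - 1)) ^ t = 1 := by
    rw [← mul_pow, mul_comm, huv, one_pow]
  have hR : Polynomial.aeval (chartX k p n i I i) ((1 + Polynomial.X) ^ N * P) =
      (1 + chartX k p n i I i) ^ N * Polynomial.aeval (chartX k p n i I i) P := by
    rw [map_mul, map_pow, map_add, map_one, Polynomial.aeval_X]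
  rw [hR]
  set Mo := algebraMap (MvPolynomial (Fin n) k) (ChartRing k p n i I) (monomial mb 1)
  calc Mo * Polynomial.aeval (chartX k p n i I i) P * chartV k p n i I ^ t *
        ((1 - chartX k p n i I i ^ (p - 1)) ^ t * (1 + chartX k p n i I i) ^ N)
      = Mo * Polynomial.aeval (chartX k p n i I i) P *
          (chartV k p n i I ^ t * (1 - chartX k p n i I i ^ (p - 1)) ^ t) * (1 + chartX k p n i I i) ^ N := by
        ring
    _ = _ := by rw [h2]; ring

include hσ in
/-- **The heart of CLAIM P.** Every `σ`-fixed element of the straightened chart ring, multiplied by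
a power of the invariant norm unit `N'`, lies in the `k`-span of the cone-monomial images
`x^m · u^{−d(m)}` (`weight m = 0`). [OURS · L1 W4.5c] -/
theorem mem_span_chartMono_of_fixed (hi : i ∈ I) (x : ChartRing k p n i I) (hx : σ x = x) :
    ∃ r : ℕ, x * chartNu k p n i I ^ r ∈
      Submodule.span k (Set.range (chartMono k p n i I : Multiplicative (coneMonoid n p (chartWeight p n I)) → ChartRing k p n i I)) := by
  classical
  haveI := chartRing_isDomain k p n i I
  haveI := chartRing_charP k p n i I
  obtain ⟨b, r, hbr⟩ := exists_mul_chartNu_pow_eq k p n i I x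
  refine ⟨r, ?_⟩
  rw [hbr]
  -- abbreviations (plain `have`-free names via `set` on non-dependent data only)
  set t : ℕ := (1 + (I.erase i).card) * r with ht
  set D₀ : ℕ := b.support.sup (fun m => m i) with hD₀
  set T : Finset (Fin n →₀ ℕ) := b.support.image (Finsupp.erase i) with hT
  set Amax : ℕ := T.sup (degA n I) with hAmax
  set N : ℕ := Amax + D₀ with hN
  have hTi : ∀ mb ∈ T, mb i = 0 := by
    intro mb hmb
    obtain ⟨m, _, rfl⟩ := Finset.mem_image.mp hmb
    exact Finsupp.erase_same
  have hPdeg : ∀ mb, (slicePoly i b D₀ mb).natDegree ≤ D₀ := fun mb => natDegree_slicePoly_le i b D₀ mb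
  have hbT : b = ∑ mb ∈ T, monomial mb (1 : k) * Polynomial.aeval (X i) (slicePoly i b D₀ mb) :=
    eq_sum_slices i b D₀ (fun m hm => Finset.le_sup (f := fun m => m i) hm)
  -- the decomposed element
  have hy : algebraMap (MvPolynomial (Fin n) k) (ChartRing k p n i I) b * chartV k p n i I ^ t =
      ∑ mb ∈ T, algebraMap (MvPolynomial (Fin n) k) (ChartRing k p n i I) (monomial mb 1) *
        Polynomial.aeval (chartX k p n i I i) (slicePoly i b D₀ mb) * chartV k p n i I ^ t := by
    conv_lhs => rw [hbT]
    rw [map_sum, Finset.sum_mul]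
    refine Finset.sum_congr rfl fun mb _ => ?_
    rw [map_mul, algebraMap_aeval_X]
  -- fixedness
  have hfix : σ (algebraMap (MvPolynomial (Fin n) k) (ChartRing k p n i I) b * chartV k p n i I ^ t) =
      algebraMap (MvPolynomial (Fin n) k) (ChartRing k p n i I) b * chartV k p n i I ^ t := by
    rw [← hbr, map_mul, map_pow, hx, sigma_chartNu k p n i I σ hσ]
  -- the slice identities `H mb = 0`
  have hslice : ∀ mb ∈ T,
      twistSubst (D₀ + (Amax - degA n I mb + degB n I mb + p * t)) (slicePoly i b D₀ mb) =
        (1 + Polynomial.X) ^ N * slicePoly i b D₀ mb := by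
    -- the combined identity in `M`, then in `k[x]`, then slice by slice
    have hsum : ∑ mb ∈ T, algebraMap (MvPolynomial (Fin n) k) (ChartRing k p n i I) (monomial mb 1) *
        Polynomial.aeval (chartX k p n i I i)
          (twistSubst (D₀ + (Amax - degA n I mb + degB n I mb + p * t)) (slicePoly i b D₀ mb) -
            (1 + Polynomial.X) ^ N * slicePoly i b D₀ mb) = 0 := by
      have h0 : (σ (algebraMap (MvPolynomial (Fin n) k) (ChartRing k p n i I) b * chartV k p n i I ^ t) -
          algebraMap (MvPolynomial (Fin n) k) (ChartRing k p n i I) b * chartV k p n i I ^ t) *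
          ((1 - chartX k p n i I i ^ (p - 1)) ^ t * (1 + chartX k p n i I i) ^ N) = 0 := by
        rw [hfix, sub_self, zero_mul]
      rw [hy, map_sum, ← Finset.sum_sub_distrib, Finset.sum_mul] at h0
      rw [← h0]
      refine Finset.sum_congr rfl fun mb hmb => ?_
      rw [sub_mul, sigma_slice_mul k p n i I σ hσ hi mb _ D₀ Amax t
        (Finset.le_sup (f := degA n I) hmb) (hPdeg mb), hN, slice_mul, map_sub, mul_sub]
    have hsumB : ∑ mb ∈ T, monomial mb (1 : k) * Polynomial.aeval (X i)
        (twistSubst (D₀ + (Amax - degA n I mb + degB n I mb + p * t)) (slicePoly i b D₀ mb) -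
          (1 + Polynomial.X) ^ N * slicePoly i b D₀ mb) = 0 := by
      apply chart_algebraMap_injective k p n i I
      rw [map_sum, map_zero, ← hsum]
      refine Finset.sum_congr rfl fun mb _ => ?_
      rw [map_mul, algebraMap_aeval_X]
    intro mb hmb
    have h := sliced_eq_zero i T hTi _ hsumB mb hmb
    exact sub_eq_zero.mp h
  -- membership slice by slice
  rw [hy]
  refine Submodule.sum_mem _ fun mb hmb => ?_
  have hA : degA n I mb ≤ Amax := Finset.le_sup (f := degA n I) hmb
  set L : ℕ := D₀ + (Amax - degA n I mb + degB n I mb + p * t) with hL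
  have hH := hslice mb hmb
  -- the slice polynomial is non-zero, hence `N ≤ L`
  have hPne : slicePoly i b D₀ mb ≠ 0 := by
    obtain ⟨m, hm, hmb'⟩ := Finset.mem_image.mp hmb
    intro h0
    have hc := congrArg (fun P => P.coeff (m i)) h0
    simp only [Polynomial.coeff_zero] at hc
    rw [coeff_slicePoly, if_pos (Finset.le_sup (f := fun m => m i) hm), ← hmb',
      Finsupp.erase_add_single] at hc
    exact (mem_support_iff.mp hm) hc
  have hNL : N ≤ L := by
    have h1 : (twistSubst L (slicePoly i b D₀ mb)).natDegree ≤ L := natDegree_twistSubst_le _ _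
    rw [hH] at h1
    have h1X : (1 + Polynomial.X : Polynomial k) = Polynomial.X + Polynomial.C 1 := by
      rw [map_one, add_comm]
    have hmon : ((1 + Polynomial.X : Polynomial k) ^ N).Monic := by
      rw [h1X]; exact (Polynomial.monic_X_add_C 1).pow N
    have hdegN : ((1 + Polynomial.X : Polynomial k) ^ N).natDegree = N := by
      rw [h1X, (Polynomial.monic_X_add_C 1).natDegree_pow, Polynomial.natDegree_X_add_C, mul_one]
    have hne : ((1 + Polynomial.X : Polynomial k) ^ N).leadingCoeff *
        (slicePoly i b D₀ mb).leadingCoeff ≠ 0 := by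
      rw [hmon.leadingCoeff, one_mul]; exact Polynomial.leadingCoeff_ne_zero.mpr hPne
    rw [Polynomial.natDegree_mul' hne, hdegN] at h1
    omega
  have hPL : (slicePoly i b D₀ mb).natDegree ≤ L := (hPdeg mb).trans (Nat.le_add_right _ _)
  obtain ⟨Dq, q, hDq, hPnf⟩ := exists_normalForm_of_twistSubst_eq_level p (slicePoly i b D₀ mb) L N hPL hNL hH
  rw [hPnf, map_sum, Finset.mul_sum, Finset.sum_mul]
  refine Submodule.sum_mem _ fun d hd => ?_
  have hd' : d ≤ Dq := Nat.lt_succ_iff.mp (Finset.mem_range.mp hd)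
  have hpd : N + p * d ≤ L := le_trans (by gcongr) hDq
  rw [aeval_normalForm_term]
  -- the term is `q d • chartMono (m*)`, `m* = mb + (L - N - p d)·eᵢ`
  set a : ℕ := L - N - p * d with ha
  have haZ : (a : ℤ) = (degB n I mb : ℤ) - degA n I mb + p * t - p * d := by
    have h1 : (a : ℤ) = ((L - N : ℕ) : ℤ) - p * d := by
      rw [ha]; push_cast [Nat.cast_sub (show p * d ≤ L - N by omega)]; ring
    have h2 : ((L - N : ℕ) : ℤ) = (L : ℤ) - N := by push_cast [Nat.cast_sub hNL]; ring
    have h3 : (L : ℤ) = D₀ + ((Amax : ℤ) - degA n I mb) + degB n I mb + p * t := by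
      rw [hL]; push_cast [Nat.cast_sub hA]; ring
    rw [h1, h2, h3, hN]; push_cast; ring
  have hkey : ((degA n I mb : ℤ) - degB n I mb + a) = (p : ℤ) * ((t : ℤ) - d) := by
    rw [haZ]; ring
  have hw0 : Finsupp.weight (chartWeight p n I) (mb + Finsupp.single i a) = 0 := by
    rw [weight_chartWeight_eq, twistDeg_add, twistDeg_single_self n i I hi,
      twistDeg_eq_degA_sub_degB, hkey, Int.cast_mul, Int.cast_natCast, ZMod.natCast_self, zero_mul]
  have hmem : mb + Finsupp.single i a ∈ coneMonoid n p (chartWeight p n I) :=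
    (mem_coneMonoid_iff n p _ _).mpr hw0
  have hdeg : coneDeg n p I (mb + Finsupp.single i a) = (t : ℤ) - d := by
    have hp0 : (p : ℤ) ≠ 0 := by exact_mod_cast (Fact.out : p.Prime).ne_zero
    have h := twistDeg_eq_mul_coneDeg n p I _ hw0
    rw [twistDeg_add, twistDeg_single_self n i I hi, twistDeg_eq_degA_sub_degB, hkey] at h
    exact (mul_left_cancel₀ hp0 h).symm
  have hterm : algebraMap (MvPolynomial (Fin n) k) (ChartRing k p n i I) (monomial mb 1) *
      (algebraMap k (ChartRing k p n i I) (q d) * chartX k p n i I i ^ a *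
        (1 - chartX k p n i I i ^ (p - 1)) ^ d) * chartV k p n i I ^ t =
      (q d) • chartMono k p n i I (Multiplicative.ofAdd ⟨mb + Finsupp.single i a, hmem⟩) := by
    rw [chartMono_apply, Algebra.smul_def]
    change _ = algebraMap k (ChartRing k p n i I) (q d) *
      (algebraMap (MvPolynomial (Fin n) k) (ChartRing k p n i I) (monomial (mb + Finsupp.single i a) 1) *
        ↑(chartUUnit k p n i I ^ (-coneDeg n p I (mb + Finsupp.single i a))))
    rw [hdeg, val_chartUUnit_zpow, ← algebraMap_monomial_mul_pow]
    ring
  rw [hterm]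
  exact Submodule.smul_mem _ _ (Submodule.subset_span ⟨_, rfl⟩)

end FixedSpan

end Summit.ResolutionOfSingularities.ResolutionOfSingularities.Theorems.WildQuotientResolution.ConductorOne

end
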